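import Summits.BirchSwinnertonDyer.Rank1Residual.P2.CMKolyvaginTamagawaSelmerAtTwo
import Summits.BirchSwinnertonDyer.BirchSwinnertonDyer.Theorems.GenusKolyvaginAtTwoVisiblePairAtTwoKolyvaginClassSign
import Summits.BirchSwinnertonDyer.BirchSwinnertonDyer.Theorems.GenusKolyvaginAtTwoPowDvdShaCardAtTwoRTRungSupply
import Summits.BirchSwinnertonDyer.BirchSwinnertonDyer.Theorems.Rank1ResidualJetSelmerLemmas
import Summits.BirchSwinnertonDyer.BirchSwinnertonDyer.Theses.GenusKolyvaginAtTwo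
import HarnessLib

/-!
# Route `GenusKolyvaginAtTwo`, LINE 18 (L_T `PowDvdShaCardAtTwoRT`, stmt-BirchSwinnertonDyer-23242), stub L
# `stub_twinShaLaddersAtTwo` — THE SUPPLY ELEMENT OF A RUNG IN KOLYVAGIN-CLASS CURRENCY: `d_{M'}(n) := 2^{L−M'} c_L(n)` is a
# SIGNED SELMER class of the right order (McCallum's `hsel` / `hsign` / `hord` at `2`, from Q2 by name + tree theorems)

Seat `bsd-line-gk2-p2` g18 (PROVER seat 2/3, cell `bsd-f1-sign2`), `--supports stmt-BirchSwinnertonDyer-23242` (helper; closes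
nothing). THEOREMS ONLY (no definition, no named fact, no `sorry`); BSD is not proved by any of this.

WHY. `…RTRungFamilies` / `…RTTwinShaLaddersOfSupplies` reduce stub L to McCallum-shaped AVOIDANCE among signed Selmer classes of
`H¹(K, E_K[2^L])` of order `2^a`; the LEAD's abstract `rungSupply_of_prop52` (`…RTRungSupply`) says the avoiding element is
`d_{M'}(n) = 2^{L−M'} c_L(n)` for a product `n` delivered by Prop. 5.2, with three displayed inputs `hsel`, `hsign`, `hord`. This file
DISCHARGES them for the tree's concrete class `c_L(n) = d.kolyvaginClass Nat.prime_two L` on L_T's habitat (odd Tamagawa product,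
Heegner `K` with odd `d_K ≠ −3`, `ρ_{E,2^∞}` onto), Q2 `KolyvaginRelationAtTwo` entering BY NAME (an antecedent of L_T):

* §1 `kolyvaginRelationAtTwo_of_mul_eq` — Q2 read at levels `n/ℓ ⊂ n` (cast of the conductor).
* §2 **`zsmul_kolyvaginClass_two_mem_selmerGroup`** — McCallum's `hsel` at `2`: if `2^j c_L(n/ℓ) = 0` for every `ℓ ∣ n`
  (`2^{L−j} ∣ P(n/ℓ)`, order law `pow_zsmul_kolyvaginClass_two_eq_zero_iff`) for data at the levels `n/ℓ` coherent with `d`, then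
  `2^j c_L(n) ∈ Sel^{(2^L)}(E_K/K)`: at `v ∤ n` by Gross Prop. 6.2 (1) at `2` (cell `bsd-print-cf2`,
  `TamagawaSelmerAtTwo.kolyvaginClass_mem_selmerLocalKer_two_pow_of_not_mem` — odd Tamagawa numbers), at `v ∣ ℓ ∣ n` by Q2
  (`Sel ↔ loc = 0 ↔ loc c_L(n/ℓ) = 0`), at `∞` because `K` is complex.
* §3 `conjAct_zsmul_kolyvaginClass_two` (`hsign`: Gross Prop. 5.4 at `2`, gk2-p3 `sign_conjAct_kolyvaginClass_two`),
  `addOrderOf_zsmul_kolyvaginClass_two` (`hord` for the multiple).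
* §4 **`exists_supplyElement_of_kolyvaginDatum`** — the avoiding element of `…RTRungFamilies`' supplies in ONE statement: Selmer,
  signed `−w(E)(−1)^{#primes of n}`, of order `2^{M'−k}` when `ord c_L(n) = 2^{L−k}`, and avoiding every `C` that `⟨c_L(n)⟩` avoids.
So each rung of L is, by name, «∃ deep square-free `n` with the right number of primes, data coherent along `n/ℓ ⊂ n`,
`2^{M_{r−1}} ∣ P(n/ℓ)`, `2^{M_r} ∥ P(n)`, `⟨c_L(n)⟩ ∩ C = 0`» — McCallum Prop. 5.2 at `2` over `K` in the tree's own currency.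

References: [McCallumLMS1991] §4 Lemma 4.3, Prop. 4.4, Cor. 4.5, Lemma 4.6; §5 p. 285, Prop. 5.2; [GrossLMS1991] Prop. 5.4, Prop. 6.2;
[MilneADT2006] I Prop. 3.8.
-/

set_option autoImplicit false
-- the Theorems namespace of this sub repeats the summit name by design (D-0017 nested layout)
set_option linter.dupNamespace false

noncomputable section

open scoped Classical

namespace Summit.BirchSwinnertonDyer.BirchSwinnertonDyer.Theorems.GenusExact.PlusDescent

open WeierstrassCurve NumberField IsDedekindDomain Field Literature.NumberTheory.EllipticCurves
  Literature.NumberTheory.GaloisRepresentations Literature.NumberTheory.EllipticCurves.ModularForms AddSubgroup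
open Summit.BirchSwinnertonDyer.BirchSwinnertonDyer.Theses.GenusKolyvaginAtTwo (KolyvaginRelationAtTwo)
open Summit.BirchSwinnertonDyer.Rank1Residual.P2 Summit.BirchSwinnertonDyer.Rank1Residual.JET

variable {K : Type} [Field K] [NumberField K] (W : WeierstrassCurve ℚ) [W.IsElliptic] [W.IsGloballyMinimal]
  [NeZero (W.conductorNorm ℤ)] (Dt : ModularParametrizationData W (W.conductorNorm ℤ)) (β : ℤ) (ι : K →+* ℂ)

/-! ## §1 Q2 at the levels `n/ℓ ⊂ n` -/

/-- **Q2 `KolyvaginRelationAtTwo` at levels `m ⊂ N = m·l`** (the conductor of the upper datum given as `N` with `m * l = N`, so that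
it applies to `(n/ℓ, n)`). [cite: McCallumLMS1991, §4 Prop. 4.4] [cite: GrossLMS1991, Prop. 6.2 (2)] -/
theorem kolyvaginRelationAtTwo_of_mul_eq (hQ2 : KolyvaginRelationAtTwo) (hcm : ¬ W.HasCM)
    (hK : IsImaginaryQuadratic K) (hne3 : NumberField.discr K ≠ -3) (hne4 : NumberField.discr K ≠ -4)
    (hH : SatisfiesHeegnerHypothesis (W.conductorNorm ℤ) K) (hsur : ∀ m : ℕ, W.HasSurjectiveModNGaloisRep (2 ^ m : ℕ))
    (M : ℕ) (hM : 1 ≤ M) {m l N : ℕ} (hN : m * l = N) (hsq : Squarefree N) (hl : l.Prime) (hlm : ¬ l ∣ m)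
    (hK' : ∀ l' ∈ N.primeFactors, Zhang2014.IsKolyvaginPrime (W.conductorNorm ℤ) W K 2 l' ∧
      M ≤ Zhang2014.kolyvaginIndex W 2 l')
    (d : KolyvaginHeegnerData Dt β ι m) (d' : KolyvaginHeegnerData Dt β ι N)
    (hσ : ∀ l' ∈ m.primeFactors, ∀ (x : ringClassField K ι m) (x' : ringClassField K ι N),
      (x : ℂ) = x' → ((d'.σ l' x' : ringClassField K ι N) : ℂ) = (d.σ l' x : ℂ))
    (hS : ∀ s ∈ d.S, ∃ s' ∈ d'.S, ∀ (x : ringClassField K ι m) (x' : ringClassField K ι N),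
      (x : ℂ) = x' → ((s' x' : ringClassField K ι N) : ℂ) = (s x : ℂ))
    (hS' : ∀ s' ∈ d'.S, ∃ s ∈ d.S, ∀ (x : ringClassField K ι m) (x' : ringClassField K ι N),
      (x : ℂ) = x' → ((s' x' : ringClassField K ι N) : ℂ) = (s x : ℂ))
    (hemb : ∀ (x : ringClassField K ι m) (x' : ringClassField K ι N), (x : ℂ) = x' → d'.emb x' = d.emb x)
    (v : HeightOneSpectrum (𝓞 K)) (hv : ((l : ℕ) : 𝓞 K) ∈ v.asIdeal) (j : ℕ) :
    (((2 ^ j : ℕ) : ℤ) • d'.kolyvaginClass Nat.prime_two M ∈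
        selmerLocalKer (W.baseChange K) (v.adicCompletion K) ((2 ^ M : ℕ) : ℤ) ↔
      ((2 ^ j : ℕ) : ℤ) • d'.kolyvaginClass Nat.prime_two M ∈
        (W.baseChange K).torsionLocalKer (v.adicCompletion K) ((2 ^ M : ℕ) : ℤ)) ∧
    (((2 ^ j : ℕ) : ℤ) • d'.kolyvaginClass Nat.prime_two M ∈
        (W.baseChange K).torsionLocalKer (v.adicCompletion K) ((2 ^ M : ℕ) : ℤ) ↔
      ((2 ^ j : ℕ) : ℤ) • d.kolyvaginClass Nat.prime_two M ∈
        (W.baseChange K).torsionLocalKer (v.adicCompletion K) ((2 ^ M : ℕ) : ℤ)) := by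
  subst hN
  exact hQ2 W hcm K hK hne3 hne4 hH hsur Dt β ι M hM m l hsq hl hlm hK' d d' hσ hS hS' hemb v hv j

/-! ## §2 McCallum's `hsel` at `2`: `2^j c_L(n)` is Selmer once `2^j c_L(n/ℓ) = 0` for every `ℓ ∣ n` -/

/-- **`2^j · c_L(n) ∈ Sel^{(2^L)}(E_K/K)` when `2^j · c_L(n/ℓ) = 0` for all `ℓ ∣ n`** (McCallum: `d_{M_{r−1}}(n) = p^{M−M_{r−1}} c_M(n)`
is Selmer since `p^{M_{r−1}} ∣ P_{n/ℓ}` — Lemma 4.3, Prop. 4.4, minimality), at `p = 2` on L_T's habitat: `W/ℚ` globally minimal,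
non-CM, `Odd W.tamagawaProduct`, `ρ_{E,2^m}` onto for all `m`; `K` imaginary quadratic, `d_K ∉ {−3, −4}`, Heegner for `N_W`; `n`
square-free with Kolyvagin prime factors of index `≥ L ≥ 1`; `d` a datum at `n` and, for each `ℓ ∣ n`, a datum at `n/ℓ` coherent with
`d` (Gross's one system of choices; tree `JET.exists_compatible_data_of_grossCM`). Proof: at finite `v ∤ n` Gross Prop. 6.2 (1) at `2`
(`TamagawaSelmerAtTwo.kolyvaginClass_mem_selmerLocalKer_two_pow_of_not_mem`), at `v ∣ ℓ ∣ n` Q2 turns the Selmer condition into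
`loc_v (2^j c_L(n/ℓ)) = 0`, at `∞` nothing (`K` complex). [cite: McCallumLMS1991, §4 Lemma 4.3, Prop. 4.4; §5 p. 285]
[cite: GrossLMS1991, Prop. 6.2] -/
theorem zsmul_kolyvaginClass_two_mem_selmerGroup (hQ2 : KolyvaginRelationAtTwo) (hcm : ¬ W.HasCM)
    (hK : IsImaginaryQuadratic K) (hne3 : NumberField.discr K ≠ -3) (hne4 : NumberField.discr K ≠ -4)
    (hH : SatisfiesHeegnerHypothesis (W.conductorNorm ℤ) K) (hodd : Odd W.tamagawaProduct)
    (hsur : ∀ m : ℕ, W.HasSurjectiveModNGaloisRep (2 ^ m : ℕ))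
    {L : ℕ} (hL : 1 ≤ L) (j : ℕ) {n : ℕ} (hn : Squarefree n)
    (hKol : ∀ ℓ ∈ n.primeFactors, Zhang2014.IsKolyvaginPrime (W.conductorNorm ℤ) W K 2 ℓ ∧ L ≤ Zhang2014.kolyvaginIndex W 2 ℓ)
    (d : KolyvaginHeegnerData Dt β ι n)
    (dsub : ∀ ℓ ∈ n.primeFactors, KolyvaginHeegnerData Dt β ι (n / ℓ))
    (hσ : ∀ ℓ (hℓ : ℓ ∈ n.primeFactors), ∀ l' ∈ (n / ℓ).primeFactors,
      ∀ (x : ringClassField K ι (n / ℓ)) (x' : ringClassField K ι n),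
      (x : ℂ) = x' → ((d.σ l' x' : ringClassField K ι n) : ℂ) = ((dsub ℓ hℓ).σ l' x : ℂ))
    (hS : ∀ ℓ (hℓ : ℓ ∈ n.primeFactors), ∀ s ∈ (dsub ℓ hℓ).S, ∃ s' ∈ d.S,
      ∀ (x : ringClassField K ι (n / ℓ)) (x' : ringClassField K ι n), (x : ℂ) = x' → ((s' x' : ringClassField K ι n) : ℂ) = (s x : ℂ))
    (hS' : ∀ ℓ (hℓ : ℓ ∈ n.primeFactors), ∀ s' ∈ d.S, ∃ s ∈ (dsub ℓ hℓ).S,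
      ∀ (x : ringClassField K ι (n / ℓ)) (x' : ringClassField K ι n), (x : ℂ) = x' → ((s' x' : ringClassField K ι n) : ℂ) = (s x : ℂ))
    (hemb : ∀ ℓ (hℓ : ℓ ∈ n.primeFactors), ∀ (x : ringClassField K ι (n / ℓ)) (x' : ringClassField K ι n),
      (x : ℂ) = x' → d.emb x' = (dsub ℓ hℓ).emb x)
    (hsub : ∀ ℓ (hℓ : ℓ ∈ n.primeFactors), ((2 ^ j : ℕ) : ℤ) • (dsub ℓ hℓ).kolyvaginClass Nat.prime_two L = 0) :
    ((2 ^ j : ℕ) : ℤ) • d.kolyvaginClass Nat.prime_two L ∈ selmerGroup (W.baseChange K) ((2 ^ L : ℕ) : ℤ) := by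
  have hn0 : n ≠ 0 := hn.ne_zero
  rw [mem_selmerGroup_iff]
  refine ⟨fun v ↦ ?_, fun w ↦ mem_selmerLocalKer_infinitePlace_of_isImaginaryQuadratic hK _ w _⟩
  by_cases hv : ((n : ℕ) : 𝓞 K) ∈ v.asIdeal
  · -- `v ∣ ℓ ∣ n`: Q2 at `n/ℓ ⊂ n`
    obtain ⟨ℓ, hℓ, hvℓ⟩ := (SelmerVocabulary.natCast_mem_iff_exists_primeFactor_mem (K := K) hn0 v).mp hv
    have hℓp : ℓ.Prime := Nat.prime_of_mem_primeFactors hℓ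
    have hℓn : ℓ ∣ n := Nat.dvd_of_mem_primeFactors hℓ
    have hN : n / ℓ * ℓ = n := Nat.div_mul_cancel hℓn
    have hlm : ¬ ℓ ∣ n / ℓ := fun h ↦ by
      have h2 : ℓ * ℓ ∣ n := by
        have h3 := Nat.mul_dvd_mul_left ℓ h
        rwa [Nat.mul_div_cancel' hℓn] at h3
      exact hℓp.one_lt.ne' (Nat.isUnit_iff.mp (hn ℓ h2))
    have hQ := kolyvaginRelationAtTwo_of_mul_eq W Dt β ι hQ2 hcm hK hne3 hne4 hH hsur L hL hN hn hℓp hlm hKol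
      (dsub ℓ hℓ) d (hσ ℓ hℓ) (hS ℓ hℓ) (hS' ℓ hℓ) (hemb ℓ hℓ) v hvℓ j
    refine hQ.1.mpr (hQ.2.mpr ?_)
    rw [hsub ℓ hℓ]
    exact AddSubgroup.zero_mem _
  · -- `v ∤ n`: Gross Prop. 6.2 (1) at `2`
    exact AddSubgroup.zsmul_mem _
      (TamagawaSelmerAtTwo.kolyvaginClass_mem_selmerLocalKer_two_pow_of_not_mem d hK hH hodd hn0 L v hv) _

/-! ## §3 `hsign` and `hord` for the multiple -/

/-- **`τ (2^j c_L(n)) = ε_n • (2^j c_L(n))`**, `ε_n = −w(E)·(−1)^{#primes of n}` (Gross Prop. 5.4 at `2`, gk2-p3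
`KolyvaginClassSign.sign_conjAct_kolyvaginClass_two`). [cite: GrossLMS1991, §5 Prop. 5.4] -/
theorem conjAct_zsmul_kolyvaginClass_two
    (hK : IsImaginaryQuadratic K) (hne3 : NumberField.discr K ≠ -3) (hne4 : NumberField.discr K ≠ -4)
    (hodd' : Odd (NumberField.discr K)) (hH : SatisfiesHeegnerHypothesis (W.conductorNorm ℤ) K)
    (hsurj : W.HasSurjectiveModNGaloisRep ((2 : ℤ) ^ 1)) (τ : K ≃ₐ[ℚ] K) (hτ : τ ≠ 1)
    {n : ℕ} (hn : Squarefree n) {L : ℕ} (hL : 1 ≤ L)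
    (hKol : ∀ ℓ ∈ n.primeFactors, Zhang2014.IsKolyvaginPrime (W.conductorNorm ℤ) W K 2 ℓ ∧ L ≤ Zhang2014.kolyvaginIndex W 2 ℓ)
    (d : KolyvaginHeegnerData Dt β ι n) (j : ℕ) :
    conjAct W τ ((2 ^ L : ℕ) : ℤ) (((2 ^ j : ℕ) : ℤ) • d.kolyvaginClass Nat.prime_two L) =
      (-W.rootNumber * (-1) ^ n.primeFactors.card) • (((2 ^ j : ℕ) : ℤ) • d.kolyvaginClass Nat.prime_two L) := by
  rw [map_zsmul, (KolyvaginClassSign.sign_conjAct_kolyvaginClass_two hK hne3 hne4 hodd' hH hsurj τ hτ Dt β ι hn hL hKol d).2,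
    smul_comm]

omit [W.IsElliptic] [W.IsGloballyMinimal] in
/-- **`ord (2^{L−M'} c_L(n)) = 2^{M'−k}` when `ord c_L(n) = 2^{L−k}`, `k ≤ M' ≤ L`** (order law `addOrderOf_kolyvaginClass_two_eq_pow_sub`
for `2^k ∥ P(n)`, then `addOrderOf_two_pow_smul_of_addOrderOf_eq`). [cite: McCallumLMS1991, §5 Prop. 5.2 (proof)] -/
theorem addOrderOf_zsmul_kolyvaginClass_two {n : ℕ} (d : KolyvaginHeegnerData Dt β ι n) {L M' k : ℕ}
    (hkM : k ≤ M') (hML : M' ≤ L) (hordc : addOrderOf (d.kolyvaginClass Nat.prime_two L) = 2 ^ (L - k)) :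
    addOrderOf (((2 ^ (L - M') : ℕ) : ℤ) • d.kolyvaginClass Nat.prime_two L) = 2 ^ (M' - k) := by
  have h := addOrderOf_two_pow_smul_of_addOrderOf_eq (a := L - M') (b := L - k) (by omega) hordc
  have hcast : ((2 ^ (L - M') : ℕ) : ℤ) = (2 ^ (L - M') : ℤ) := by push_cast; rfl
  rw [hcast, h]
  congr 1
  omega

/-! ## §4 The supply element of a rung, in one statement -/

/-- **THE SUPPLY ELEMENT OF A RUNG FROM A KOLYVAGIN DATUM** (McCallum p. 285: `d_{M'}(n)`, at `p = 2`). On L_T's habitat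
(`W/ℚ` globally minimal, non-CM, `Odd W.tamagawaProduct`, `ρ_{E,2^m}` onto for all `m`; `K` imaginary quadratic with odd
`d_K ≠ −3`, Heegner for `N_W`; `τ ≠ 1`), granted Q2, let `n` be square-free with Kolyvagin prime factors of index `≥ L ≥ 1`, `d` a
datum at `n` with data at the `n/ℓ` coherent with it, `k ≤ M' ≤ L`, `ord c_L(n) = 2^{L−k}` (`2^k ∥ P(n)`) and `2^{L−M'} c_L(n/ℓ) = 0` for
all `ℓ ∣ n` (`2^{M'} ∣ P(n/ℓ)`). Then `y := 2^{L−M'} c_L(n)` is a SELMER class with `τ y = ε_n • y`, `ε_n = −w(E)(−1)^{#primes of n} ∈ {±1}`,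
of order `2^{M'−k}`, and `⟨y⟩` avoids every subgroup that `⟨c_L(n)⟩` avoids — the element the supplies `hsup` (ε_n = 1) / `hsup'`
(ε_n = −1) of `twinShaLadders_of_Kside_supplies` ask for. [cite: McCallumLMS1991, §5 p. 285, Prop. 5.2] [cite: GrossLMS1991, Prop. 5.4, Prop. 6.2] -/
theorem exists_supplyElement_of_kolyvaginDatum (hQ2 : KolyvaginRelationAtTwo) (hcm : ¬ W.HasCM)
    (hK : IsImaginaryQuadratic K) (hne3 : NumberField.discr K ≠ -3) (hodd' : Odd (NumberField.discr K))
    (hH : SatisfiesHeegnerHypothesis (W.conductorNorm ℤ) K) (hodd : Odd W.tamagawaProduct)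
    (hsur : ∀ m : ℕ, W.HasSurjectiveModNGaloisRep (2 ^ m : ℕ)) (τ : K ≃ₐ[ℚ] K) (hτ : τ ≠ 1)
    {L M' k : ℕ} (hL : 1 ≤ L) (hkM : k ≤ M') (hML : M' ≤ L) {n : ℕ} (hn : Squarefree n)
    (hKol : ∀ ℓ ∈ n.primeFactors, Zhang2014.IsKolyvaginPrime (W.conductorNorm ℤ) W K 2 ℓ ∧ L ≤ Zhang2014.kolyvaginIndex W 2 ℓ)
    (d : KolyvaginHeegnerData Dt β ι n)
    (dsub : ∀ ℓ ∈ n.primeFactors, KolyvaginHeegnerData Dt β ι (n / ℓ))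
    (hσ : ∀ ℓ (hℓ : ℓ ∈ n.primeFactors), ∀ l' ∈ (n / ℓ).primeFactors,
      ∀ (x : ringClassField K ι (n / ℓ)) (x' : ringClassField K ι n),
      (x : ℂ) = x' → ((d.σ l' x' : ringClassField K ι n) : ℂ) = ((dsub ℓ hℓ).σ l' x : ℂ))
    (hS : ∀ ℓ (hℓ : ℓ ∈ n.primeFactors), ∀ s ∈ (dsub ℓ hℓ).S, ∃ s' ∈ d.S,
      ∀ (x : ringClassField K ι (n / ℓ)) (x' : ringClassField K ι n), (x : ℂ) = x' → ((s' x' : ringClassField K ι n) : ℂ) = (s x : ℂ))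
    (hS' : ∀ ℓ (hℓ : ℓ ∈ n.primeFactors), ∀ s' ∈ d.S, ∃ s ∈ (dsub ℓ hℓ).S,
      ∀ (x : ringClassField K ι (n / ℓ)) (x' : ringClassField K ι n), (x : ℂ) = x' → ((s' x' : ringClassField K ι n) : ℂ) = (s x : ℂ))
    (hemb : ∀ ℓ (hℓ : ℓ ∈ n.primeFactors), ∀ (x : ringClassField K ι (n / ℓ)) (x' : ringClassField K ι n),
      (x : ℂ) = x' → d.emb x' = (dsub ℓ hℓ).emb x)
    (hsub : ∀ ℓ (hℓ : ℓ ∈ n.primeFactors), ((2 ^ (L - M') : ℕ) : ℤ) • (dsub ℓ hℓ).kolyvaginClass Nat.prime_two L = 0)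
    (hordc : addOrderOf (d.kolyvaginClass Nat.prime_two L) = 2 ^ (L - k)) :
    ∃ y : galH1Torsion (W.baseChange K) ((2 ^ L : ℕ) : ℤ),
      y = ((2 ^ (L - M') : ℕ) : ℤ) • d.kolyvaginClass Nat.prime_two L ∧
      y ∈ selmerGroup (W.baseChange K) ((2 ^ L : ℕ) : ℤ) ∧
      conjAct W τ ((2 ^ L : ℕ) : ℤ) y = (-W.rootNumber * (-1) ^ n.primeFactors.card) • y ∧
      (-W.rootNumber * (-1) ^ n.primeFactors.card = 1 ∨ -W.rootNumber * (-1) ^ n.primeFactors.card = -1) ∧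
      addOrderOf y = 2 ^ (M' - k) ∧
      ∀ C : AddSubgroup (galH1Torsion (W.baseChange K) ((2 ^ L : ℕ) : ℤ)),
        Disjoint (zmultiples (d.kolyvaginClass Nat.prime_two L)) C → Disjoint (zmultiples y) C := by
  have hne4 : NumberField.discr K ≠ -4 := fun h ↦ by
    rw [h] at hodd'
    exact (Int.not_even_iff_odd.mpr hodd') ⟨-2, by norm_num⟩
  have hsurj1 : W.HasSurjectiveModNGaloisRep ((2 : ℤ) ^ 1) := by exact_mod_cast hsur 1
  refine ⟨_, rfl, zsmul_kolyvaginClass_two_mem_selmerGroup W Dt β ι hQ2 hcm hK hne3 hne4 hH hodd hsur hL (L - M') hn hKol d dsub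
    hσ hS hS' hemb hsub, conjAct_zsmul_kolyvaginClass_two W Dt β ι hK hne3 hne4 hodd' hH hsurj1 τ hτ hn hL hKol d (L - M'),
    (KolyvaginClassSign.sign_conjAct_kolyvaginClass_two hK hne3 hne4 hodd' hH hsurj1 τ hτ Dt β ι hn hL hKol d).1,
    addOrderOf_zsmul_kolyvaginClass_two W Dt β ι d hkM hML hordc, fun C hC ↦ ?_⟩
  exact hC.mono_left (zmultiples_le_of_mem (zsmul_mem (mem_zmultiples _) _))

end Summit.BirchSwinnertonDyer.BirchSwinnertonDyer.Theorems.GenusExact.PlusDescent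

end
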